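import Literature.Analysis.Complex.LengthAreaDiameter
import HarnessLib

/-!
# The length–area modulus of continuity for enclosed sets

Complement to `Literature/Analysis/Complex/LengthAreaDiameter.lean`
(`Literature.Analysis.Complex.LengthArea.norm_sub_le_of_isPreconnected`: for a conformal
bijection `g : U → ℍ` moving points by at most `C₀`, a preconnected `Q ⊆ U ∩ B(p, d)`,
`0 < d < 1`, has `diam g(Q) ≤ 8π (1 + C₀)/√(log (1/d))`). In Loewner's slit theorem (G. F. Lawler,
*Conformally Invariant Processes in the Plane* (2005), §4.1; [LSW] proof of Lemma 3.5, p. 13,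
"`Φ_s = Φ_{E_δ}`") one also needs the smallness of `g_t(E ∖ β[0, t])` as `t ↑ s`, where `E` is
the hull enclosed by the closed path `β[0, s]` and `g_t` the map of the slit `β[0, t]`: the set
`Q = (E ∩ ℍ) ∖ β[0, t]` is NOT small, but every path from `Q` to `∞` inside `ℍ ∖ β[0, t]` must
cross the remaining piece `β(t, s)` of the boundary of `E`, which is small. The projection trick
of `LengthAreaDiameter` only uses this property of `Q`, so we record the generalization:

* `Literature.Analysis.Complex.LengthArea.IsEnclosedBy U Q p d R₀` — every path in `U` from a
  point of `Q` to a point of modulus `≥ R₀` passes within distance `d` of `p`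
  (`isEnclosedBy_of_subset` : automatic for `Q ⊆ B̄(p, d)`);
* `Literature.Analysis.Complex.LengthArea.norm_sub_le_of_isEnclosedBy` — for such a preconnected
  `Q ⊆ U` and `0 < d < 1`, again **`‖g z₁ - g z₂‖ ≤ 8π (1 + C₀)/√(log (1/d))`** on `Q`.

The proof is that of `norm_sub_le_of_isPreconnected` (Wolff's length–area lemma on the circles
`{|z - p| = ρ}`, `d < ρ < √d`, Pommerenke (1992) Prop. 2.2, and projection to the axes), with the
crossing lemma adapted: the pulled-back ray starts in `Q`, reaches modulus `≥ R₀`, hence comes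
within `d < ρ` of `p` and then leaves `B(p, ρ)`.

## References

* Ch. Pommerenke, *Boundary Behaviour of Conformal Maps*, Springer (1992), Prop. 2.2.
  [PommerenkeBBCM1992]
* G. F. Lawler, *Conformally Invariant Processes in the Plane*, AMS (2005), §4.1 (Lemma 4.1,
  Prop. 4.4). [Lawler2005]
-/

noncomputable section

open Set Filter Metric MeasureTheory Real
open _root_.Complex _root_.Topology
open UpperHalfPlane (upperHalfPlaneSet)
open scoped ENNReal NNReal

namespace Literature.Analysis.Complex

namespace LengthArea

variable {U Q : Set ℂ} {g f : ℂ → ℂ} {p : ℂ} {ρ d R₀ C₀ : ℝ}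

/-- **Enclosure**: every path `γ : [a, b] → U` from a point of `Q` to a point of modulus `≥ R₀`
passes within distance `d` of `p`. [folklore] -/
def IsEnclosedBy (U Q : Set ℂ) (p : ℂ) (d R₀ : ℝ) : Prop :=
  ∀ (γ : ℝ → ℂ) (a b : ℝ), a ≤ b → ContinuousOn γ (Icc a b) → (∀ s ∈ Icc a b, γ s ∈ U) →
    γ a ∈ Q → R₀ ≤ ‖γ b‖ → ∃ s ∈ Icc a b, ‖γ s - p‖ ≤ d

/-- A set inside `B̄(p, d)` is enclosed (the path starts within `d` of `p`). [folklore] -/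
theorem isEnclosedBy_of_subset (hQd : Q ⊆ closedBall p d) : IsEnclosedBy U Q p d R₀ :=
  fun _ a _ hab _ _ hγa _ ↦ ⟨a, left_mem_Icc.2 hab, by
    have := hQd hγa
    rwa [mem_closedBall, dist_eq_norm] at this⟩

/-- Enclosure is monotone in the set. [folklore] -/
theorem IsEnclosedBy.mono (h : IsEnclosedBy U Q p d R₀) {Q' : Set ℂ} (hQ' : Q' ⊆ Q) :
    IsEnclosedBy U Q' p d R₀ :=
  fun γ a b hab hγ hγU hγa hb ↦ h γ a b hab hγ hγU (hQ' hγa) hb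

section Trick

variable (hgU : MapsTo g U upperHalfPlaneSet) (hfU : MapsTo f upperHalfPlaneSet U)
  (hfc : ContinuousOn f upperHalfPlaneSet) (hgf : ∀ w ∈ upperHalfPlaneSet, g (f w) = w)
  (hfg : ∀ z ∈ U, f (g z) = z) (hC : ∀ z ∈ U, ‖g z - z‖ ≤ C₀)
include hgU hfU hfc hgf hfg hC

omit hgU hfg in
/-- **Crossing lemma for enclosed sets**: a ray `s ↦ w + s v` in `ℍ` starting at a point `w`
with `f w ∈ Q` is pulled back by `f` to a path in `U` from `Q` to points of large modulus; it
therefore comes within `d < ρ` of `p` and afterwards leaves `B(p, ρ)`, so some point of the ray is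
the `g`-image of a point of `U ∩ {|z - p| = ρ}`. [folklore] -/
theorem exists_mem_image_inter_sphere_of_isEnclosedBy {w v : ℂ} (hv : ‖v‖ = 1)
    (hray : ∀ s : ℝ, 0 ≤ s → w + s * v ∈ upperHalfPlaneSet) (hρ1 : ρ < 1) (hdρ : d < ρ)
    (henc : IsEnclosedBy U Q p d R₀) (hw : f w ∈ Q) :
    ∃ s : ℝ, 0 ≤ s ∧ w + s * v ∈ g '' (U ∩ sphere p ρ) := by
  set H : ℝ := ‖w‖ + ‖p‖ + C₀ + |R₀| + 2 with hH
  have hC0 : 0 ≤ C₀ := (norm_nonneg _).trans (hC (f w) (hfU (by simpa using hray 0 le_rfl)))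
  have hH0 : 0 ≤ H := by positivity
  set γ : ℝ → ℂ := fun s ↦ f (w + s * v) with hγ
  have hγc : ContinuousOn γ (Icc 0 H) := hfc.comp (by fun_prop) fun s hs ↦ hray s hs.1
  have hγU : ∀ s ∈ Icc 0 H, γ s ∈ U := fun s hs ↦ hfU (hray s hs.1)
  -- the endpoint is far: `‖γ H‖ ≥ R₀` and `‖γ H - p‖ ≥ 2`
  set x : ℂ := w + H * v with hx
  have hfar : ‖f x - x‖ ≤ C₀ := norm_inverse_sub_le hfU hgf hC (hray H hH0)
  have hHv : ‖(H : ℂ) * v‖ = H := by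
    rw [norm_mul, hv, mul_one, Complex.norm_real, Real.norm_eq_abs, abs_of_nonneg hH0]
  have hx1 : H ≤ ‖x‖ + ‖w‖ := by
    calc H = ‖(H : ℂ) * v‖ := hHv.symm
      _ = ‖x - w‖ := by rw [hx]; ring_nf
      _ ≤ ‖x‖ + ‖w‖ := norm_sub_le _ _
  have hx2 : ‖x‖ ≤ ‖f x‖ + ‖f x - x‖ := by
    calc ‖x‖ = ‖f x - (f x - x)‖ := by ring_nf
      _ ≤ ‖f x‖ + ‖f x - x‖ := norm_sub_le _ _
  have hγH : R₀ ≤ ‖γ H‖ := by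
    have : γ H = f x := rfl
    rw [this]
    linarith [le_abs_self R₀, norm_nonneg p]
  have hx3 : H ≤ ‖x - p‖ + ‖w‖ + ‖p‖ := by
    calc H = ‖(H : ℂ) * v‖ := hHv.symm
      _ = ‖(x - p) - (w - p)‖ := by rw [hx]; ring_nf
      _ ≤ ‖x - p‖ + ‖w - p‖ := norm_sub_le _ _
      _ ≤ ‖x - p‖ + (‖w‖ + ‖p‖) := by gcongr; exact norm_sub_le w p
      _ = ‖x - p‖ + ‖w‖ + ‖p‖ := by ring
  have hx4 : ‖x - p‖ ≤ ‖f x - p‖ + ‖f x - x‖ := by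
    calc ‖x - p‖ = ‖(f x - p) - (f x - x)‖ := by
          rw [show f x - p - (f x - x) = x - p by ring]
      _ ≤ ‖f x - p‖ + ‖f x - x‖ := norm_sub_le _ _
  have hHρ : ρ ≤ ‖γ H - p‖ := by
    have : γ H = f x := rfl
    rw [this]
    linarith [abs_nonneg R₀]
  -- the path comes within `d` of `p`
  obtain ⟨s₁, hs₁, hs₁d⟩ := henc γ 0 H hH0 hγc hγU (by simpa [hγ] using hw) hγH
  -- intermediate value on `[s₁, H]`
  set h : ℝ → ℝ := fun s ↦ ‖γ s - p‖ with hh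
  have hcont : ContinuousOn h (Icc s₁ H) :=
    ((hγc.mono (Icc_subset_Icc hs₁.1 le_rfl)).sub continuousOn_const).norm
  obtain ⟨s, hs, hsρ⟩ := intermediate_value_Icc hs₁.2 hcont ⟨hs₁d.trans hdρ.le, hHρ⟩
  have hs0 : 0 ≤ s := hs₁.1.trans hs.1
  refine ⟨s, hs0, f (w + s * v), ⟨hfU (hray s hs0), ?_⟩, hgf _ (hray s hs0)⟩
  exact mem_sphere_iff_norm.2 hsρ

/-- `re (g q) ∈ re(Γ_ρ)` for `q` in an enclosed `Q ⊆ U` (vertical rays). [folklore] -/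
theorem re_mem_image_of_isEnclosedBy (hρ1 : ρ < 1) (hdρ : d < ρ) (henc : IsEnclosedBy U Q p d R₀)
    (hQU : Q ⊆ U) {q : ℂ} (hq : q ∈ Q) : (g q).re ∈ re '' (g '' (U ∩ sphere p ρ)) := by
  have hw : g q ∈ upperHalfPlaneSet := hgU (hQU hq)
  have hray : ∀ s : ℝ, 0 ≤ s → g q + s * I ∈ upperHalfPlaneSet := fun s hs ↦ by
    show 0 < (g q + s * I).im
    have : 0 < (g q).im := hw
    simp only [add_im, mul_im, ofReal_re, I_im, mul_one, ofReal_im, I_re, mul_zero, add_zero]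
    linarith
  obtain ⟨s, -, hs⟩ := exists_mem_image_inter_sphere_of_isEnclosedBy hfU hfc hgf hC (by simp) hray
    hρ1 hdρ henc (by rw [hfg q (hQU hq)]; exact hq)
  exact ⟨_, hs, by simp⟩

/-- `im (g q) ∈ im(Γ_ρ)` for `q` in an enclosed `Q ⊆ U` (horizontal rays). [folklore] -/
theorem im_mem_image_of_isEnclosedBy (hρ1 : ρ < 1) (hdρ : d < ρ) (henc : IsEnclosedBy U Q p d R₀)
    (hQU : Q ⊆ U) {q : ℂ} (hq : q ∈ Q) : (g q).im ∈ im '' (g '' (U ∩ sphere p ρ)) := by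
  have hw : g q ∈ upperHalfPlaneSet := hgU (hQU hq)
  have hray : ∀ s : ℝ, 0 ≤ s → g q + s * (1 : ℂ) ∈ upperHalfPlaneSet := fun s _ ↦ by
    show 0 < (g q + s * 1).im
    have : 0 < (g q).im := hw
    simpa using this
  obtain ⟨s, -, hs⟩ := exists_mem_image_inter_sphere_of_isEnclosedBy hfU hfc hgf hC (by simp) hray
    hρ1 hdρ henc (by rw [hfg q (hQU hq)]; exact hq)
  exact ⟨_, hs, by simp⟩

end Trick

/-- **Uniform modulus of continuity on enclosed sets.** Let `U ⊆ ℂ` be open, `g` holomorphic on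
`U` with `g(U) ⊆ ℍ`, `f : ℍ → U` a continuous inverse (`g ∘ f = id` on `ℍ`, `f ∘ g = id` on
`U`), `‖g z - z‖ ≤ C₀` on `U`. If the preconnected `Q ⊆ U` is enclosed in the sense of
`IsEnclosedBy U Q p d R₀` with `0 < d < 1`, then for all `z₁, z₂ ∈ Q`:
`‖g z₁ - g z₂‖ ≤ 8π (1 + C₀) / √(log (1/d))`. (As `norm_sub_le_of_isPreconnected`, the case
`Q ⊆ B(p, d)`.) [folklore] -/
theorem norm_sub_le_of_isEnclosedBy (hU : IsOpen U) (hg : DifferentiableOn ℂ g U)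
    (hgU : MapsTo g U upperHalfPlaneSet)
    (hfU : MapsTo f upperHalfPlaneSet U) (hfc : ContinuousOn f upperHalfPlaneSet)
    (hgf : ∀ w ∈ upperHalfPlaneSet, g (f w) = w) (hfg : ∀ z ∈ U, f (g z) = z)
    (hC : ∀ z ∈ U, ‖g z - z‖ ≤ C₀)
    (hd : 0 < d) (hd1 : d < 1) (hQ : IsPreconnected Q) (hQU : Q ⊆ U)
    (henc : IsEnclosedBy U Q p d R₀) {z₁ z₂ : ℂ} (hz₁ : z₁ ∈ Q) (hz₂ : z₂ ∈ Q) :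
    ‖g z₁ - g z₂‖ ≤ 8 * π * (1 + C₀) / √(Real.log (1 / d)) := by
  have hinj : InjOn g U := fun a ha b hb hab ↦ by rw [← hfg a ha, ← hfg b hb, hab]
  have hC₀ : 0 ≤ C₀ := (norm_nonneg _).trans (hC z₁ (hQU hz₁))
  set U' : Set ℂ := U ∩ ball p 1 with hU'
  have hU'o : IsOpen U' := hU.inter isOpen_ball
  have hg' : DifferentiableOn ℂ g U' := hg.mono inter_subset_left
  have hinj' : InjOn g U' := hinj.mono inter_subset_left
  have himg : g '' U' ⊆ ball p (1 + C₀) := by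
    rintro _ ⟨z, ⟨hzU, hz⟩, rfl⟩
    rw [mem_ball, dist_eq_norm] at hz ⊢
    calc ‖g z - p‖ = ‖(g z - z) + (z - p)‖ := by ring_nf
      _ ≤ ‖g z - z‖ + ‖z - p‖ := norm_add_le _ _
      _ < C₀ + 1 := add_lt_add_of_le_of_lt (hC z hzU) hz
      _ = 1 + C₀ := add_comm _ _
  have hvol : volume (g '' U') ≤ ENNReal.ofReal ((1 + C₀) ^ 2 * π) := by
    refine (measure_mono himg).trans (le_of_eq ?_)
    rw [Complex.volume_ball, ENNReal.ofReal_mul (by positivity), ← ENNReal.ofReal_pow (by positivity),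
      ← NNReal.coe_real_pi, ENNReal.ofReal_coe_nnreal]
  set K : ℝ≥0∞ := ENNReal.ofReal (2 * π) * ENNReal.ofReal ((1 + C₀) ^ 2 * π) with hKdef
  have hKtop : K ≠ ⊤ := ENNReal.mul_ne_top ENNReal.ofReal_ne_top ENNReal.ofReal_ne_top
  have hKreal : K.toReal = 2 * π * ((1 + C₀) ^ 2 * π) := by
    rw [hKdef, ENNReal.toReal_mul, ENNReal.toReal_ofReal (by positivity),
      ENNReal.toReal_ofReal (by positivity)]
  have hLA : ∫⁻ r in Ioi (0 : ℝ), ENNReal.ofReal r * angLenAt U' g p r ^ 2 ≤ K :=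
    (lintegral_angLenAt_sq_le hU'o hg' hinj' p).trans (by
      rw [hKdef]
      gcongr)
  obtain ⟨ρ, ⟨hdρ, hρd⟩, hρ⟩ := exists_mem_Ioo_mul_le hLA hKtop hd hd1
  set c : ℝ := √(4 * (K.toReal + 1) / Real.log (1 / d)) with hcdef
  have hc0 : 0 ≤ c := Real.sqrt_nonneg _
  have hρ0 : 0 < ρ := hd.trans hdρ
  have hρ1 : ρ < 1 := hρd.trans ((Real.sqrt_lt' one_pos).2 (by simpa using hd1))
  have hsph : U ∩ sphere p ρ = U' ∩ sphere p ρ := by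
    ext z
    simp only [hU', mem_inter_iff, mem_sphere, mem_ball]
    constructor
    · rintro ⟨hzU, hz⟩; exact ⟨⟨hzU, by rw [hz]; exact hρ1⟩, hz⟩
    · rintro ⟨⟨hzU, -⟩, hz⟩; exact ⟨hzU, hz⟩
  have hre : volume (re '' (g '' (U ∩ sphere p ρ))) ≤ ENNReal.ofReal c := by
    rw [hsph]
    refine (volume_image_image_le hU'o hg' hρ0 reCLM fun z ↦ ?_).trans hρ
    simpa using abs_re_le_norm z
  have him : volume (im '' (g '' (U ∩ sphere p ρ))) ≤ ENNReal.ofReal c := by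
    rw [hsph]
    refine (volume_image_image_le hU'o hg' hρ0 imCLM fun z ↦ ?_).trans hρ
    simpa using abs_im_le_norm z
  have hcont : ContinuousOn g Q := hg.continuousOn.mono hQU
  have hreS : (re '' (g '' Q)).OrdConnected := by
    rw [← image_comp]
    exact ((hQ.image _ (continuous_re.comp_continuousOn hcont))).ordConnected
  have himS : (im '' (g '' Q)).OrdConnected := by
    rw [← image_comp]
    exact ((hQ.image _ (continuous_im.comp_continuousOn hcont))).ordConnected
  have hreT : re '' (g '' Q) ⊆ re '' (g '' (U ∩ sphere p ρ)) := by
    rintro _ ⟨_, ⟨q, hq, rfl⟩, rfl⟩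
    exact re_mem_image_of_isEnclosedBy hgU hfU hfc hgf hfg hC hρ1 hdρ henc hQU hq
  have himT : im '' (g '' Q) ⊆ im '' (g '' (U ∩ sphere p ρ)) := by
    rintro _ ⟨_, ⟨q, hq, rfl⟩, rfl⟩
    exact im_mem_image_of_isEnclosedBy hgU hfU hfc hgf hfg hC hρ1 hdρ henc hQU hq
  have h1 : |(g z₁).re - (g z₂).re| ≤ c :=
    abs_sub_le_of_ordConnected hreS hreT hc0 hre ⟨g z₁, ⟨z₁, hz₁, rfl⟩, rfl⟩
      ⟨g z₂, ⟨z₂, hz₂, rfl⟩, rfl⟩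
  have h2 : |(g z₁).im - (g z₂).im| ≤ c :=
    abs_sub_le_of_ordConnected himS himT hc0 him ⟨g z₁, ⟨z₁, hz₁, rfl⟩, rfl⟩
      ⟨g z₂, ⟨z₂, hz₂, rfl⟩, rfl⟩
  have hlog : 0 < Real.log (1 / d) := Real.log_pos (by rw [lt_div_iff₀ hd]; linarith)
  have hc_le : c ≤ 4 * π * (1 + C₀) / √(Real.log (1 / d)) := by
    rw [hcdef, hKreal, Real.sqrt_div' _ hlog.le, div_le_div_iff_of_pos_right (Real.sqrt_pos.2 hlog)]
    have hπ : (2 : ℝ) ≤ π := Real.two_le_pi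
    have hC1 : (1 : ℝ) ≤ (1 + C₀) ^ 2 := by nlinarith
    have hπ2 : (4 : ℝ) ≤ π ^ 2 := by nlinarith
    have hkey : 4 * (2 * π * ((1 + C₀) ^ 2 * π) + 1) ≤ (4 * π * (1 + C₀)) ^ 2 := by
      nlinarith [mul_le_mul hπ2 hC1 (by norm_num) (by positivity)]
    calc √(4 * (2 * π * ((1 + C₀) ^ 2 * π) + 1)) ≤ √((4 * π * (1 + C₀)) ^ 2) :=
          Real.sqrt_le_sqrt hkey
      _ = 4 * π * (1 + C₀) := Real.sqrt_sq (by positivity)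
  calc ‖g z₁ - g z₂‖ ≤ |(g z₁ - g z₂).re| + |(g z₁ - g z₂).im| := norm_le_abs_re_add_abs_im _
    _ = |(g z₁).re - (g z₂).re| + |(g z₁).im - (g z₂).im| := by simp
    _ ≤ c + c := add_le_add h1 h2
    _ ≤ 4 * π * (1 + C₀) / √(Real.log (1 / d)) + 4 * π * (1 + C₀) / √(Real.log (1 / d)) :=
        add_le_add hc_le hc_le
    _ = 8 * π * (1 + C₀) / √(Real.log (1 / d)) := by ring

end LengthArea

end Literature.Analysis.Complex
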